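import Literature.Barriers.Schanuel.EFunctionValuesAtAlgebraicPointsForms
import Mathlib.Algebra.Polynomial.Roots
import HarnessLib

/-!
# Barrier (Schanuel) `EFunctionValuesAtAlgebraicPoints`: power-series solutions at a regular point (Baker Ch. 11 §2) — proofs only

`Literature/Barriers/Schanuel/EFunctionValuesAtAlgebraicPointsSolutions.lean` — sibling file of
`EFunctionValuesAtAlgebraicPoints.lean` in the programme to discharge `siegelShidlovskii_algIndep`
(Siegel–Shidlovskii; Rivoal Thm. 5.10 = Baker Thm. 11.1). Baker's proof of Shidlovskii's lemma
(Ch. 11, Lemma 2, p. 111) uses "power series solutions `w₁, …, wₙ` of (1) linearly independent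
over `K`". This file constructs them, by the Cauchy recursion on coefficients, for a system
`yᵢ′ = ∑ⱼ Aᵢⱼ yⱼ` with `A ∈ Mₙ(K⟦X⟧)` (`SiegelShidlovskii.solSeries`, `derivative_solSeries`,
`constantCoeff_solSeries`), and packages the consequence for Baker's system
`f yᵢ′ = ∑ Gᵢⱼ yⱼ` expanded at a point `z₀ ∈ K` with `f(z₀) ≠ 0` (a REGULAR point, where
`f(X + z₀)` is a unit of `K⟦X⟧`): `n` solutions `fundSol … l` in the sense of
`SiegelShidlovskii.IsSol (shiftAlgHom K z₀)` with `fundSol l (0) = eₗ`, linearly independent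
over `K` (`linearIndependent_fundSol`); and the existence of a regular point
(`exists_eval_ne_zero`, `K` being infinite).

All [folklore] (formal Cauchy theorem for linear systems at an ordinary point); no named facts.

## References

* A. Baker, *Transcendental Number Theory*, CUP 1975, Ch. 11 §2, proof of Lemma 2 (p. 111).
-/

noncomputable section

open Polynomial PowerSeries

namespace Literature.Barriers.Schanuel

namespace SiegelShidlovskii

variable {K : Type*} [Field K]
variable {n : ℕ}

/-! ### 1. The Cauchy recursion -/

/-- Taylor coefficients of the solution of `y′ = A y`, `y(0) = v`:
`(m+1) c_{m+1} = ∑_{l ≤ m} a_l c_{m-l}` where `a_l` is the `l`-th coefficient matrix of `A`.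
[folklore] -/
def solCoeff (a : ℕ → Matrix (Fin n) (Fin n) K) (v : Fin n → K) : ℕ → (Fin n → K)
  | 0 => v
  | m + 1 => ((m + 1 : ℕ) : K)⁻¹ • ∑ l : Fin (m + 1), (a l).mulVec (solCoeff a v (m - l))
  decreasing_by omega

/-- Initial value of the recursion. [folklore] -/
theorem solCoeff_zero (a : ℕ → Matrix (Fin n) (Fin n) K) (v : Fin n → K) : solCoeff a v 0 = v := by
  rw [solCoeff]

/-- The recursion step. [folklore] -/
theorem solCoeff_succ (a : ℕ → Matrix (Fin n) (Fin n) K) (v : Fin n → K) (m : ℕ) :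
    solCoeff a v (m + 1) =
      ((m + 1 : ℕ) : K)⁻¹ • ∑ l : Fin (m + 1), (a l).mulVec (solCoeff a v (m - l)) := by
  rw [solCoeff]

/-- The recursion step, multiplied out (characteristic zero). [folklore] -/
theorem succ_mul_solCoeff_succ [CharZero K] (a : ℕ → Matrix (Fin n) (Fin n) K) (v : Fin n → K)
    (m : ℕ) (i : Fin n) :
    ((m + 1 : ℕ) : K) * solCoeff a v (m + 1) i =
      ∑ l ∈ Finset.range (m + 1), ∑ j, a l i j * solCoeff a v (m - l) j := by
  rw [solCoeff_succ, Pi.smul_apply, smul_eq_mul, ← mul_assoc,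
    mul_inv_cancel₀ (by exact_mod_cast Nat.succ_ne_zero m), one_mul, Finset.sum_apply,
    ← Fin.sum_univ_eq_sum_range (fun l => ∑ j, a l i j * solCoeff a v (m - l) j)]
  rfl

/-! ### 2. The power-series solutions of `y′ = A y` -/

/-- The power-series solution of `y′ = A y` with initial value `v`. [folklore] -/
def solSeries (A : Matrix (Fin n) (Fin n) (PowerSeries K)) (v : Fin n → K) : Fin n → PowerSeries K :=
  fun i => PowerSeries.mk fun m => solCoeff (fun l => A.map (coeff l)) v m i

/-- Coefficients of `solSeries`. [folklore] -/
@[simp] theorem coeff_solSeries (A : Matrix (Fin n) (Fin n) (PowerSeries K)) (v : Fin n → K)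
    (m : ℕ) (i : Fin n) : coeff m (solSeries A v i) = solCoeff (fun l => A.map (coeff l)) v m i := by
  simp [solSeries]

/-- Initial value: `solSeries A v (0) = v`. [folklore] -/
theorem constantCoeff_solSeries (A : Matrix (Fin n) (Fin n) (PowerSeries K)) (v : Fin n → K)
    (i : Fin n) : constantCoeff (solSeries A v i) = v i := by
  rw [← coeff_zero_eq_constantCoeff_apply, coeff_solSeries, solCoeff_zero]

/-- **`solSeries` solves `y′ = A y`** (formal Cauchy theorem). [folklore] -/
theorem derivative_solSeries [CharZero K] (A : Matrix (Fin n) (Fin n) (PowerSeries K))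
    (v : Fin n → K) (i : Fin n) :
    derivative K (solSeries A v i) = ∑ j, A i j * solSeries A v j := by
  ext m
  rw [PowerSeries.coeff_derivative, coeff_solSeries, mul_comm,
    show ((m : K) + 1) = ((m + 1 : ℕ) : K) by push_cast; ring, succ_mul_solCoeff_succ, map_sum]
  simp only [Matrix.map_apply]
  rw [Finset.sum_comm]
  refine Finset.sum_congr rfl fun j _ => ?_
  rw [PowerSeries.coeff_mul, Finset.Nat.sum_antidiagonal_eq_sum_range_succ_mk]
  simp only [coeff_solSeries]

/-- `solSeries` is `K`-linear in the initial value: it vanishes at `v = 0` … [folklore] -/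
theorem solCoeff_linear (a : ℕ → Matrix (Fin n) (Fin n) K) (c : K) (v v' : Fin n → K) :
    ∀ m, solCoeff a (c • v + v') m = c • solCoeff a v m + solCoeff a v' m := by
  intro m
  induction m using Nat.strong_induction_on with
  | _ m ih =>
    cases m with
    | zero => simp [solCoeff_zero]
    | succ m =>
      have key : ∀ l : Fin (m + 1), (a l).mulVec (solCoeff a (c • v + v') (m - l)) =
          c • (a l).mulVec (solCoeff a v (m - l)) + (a l).mulVec (solCoeff a v' (m - l)) := by
        intro l
        rw [ih (m - l) (by omega), Matrix.mulVec_add, Matrix.mulVec_smul]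
      rw [solCoeff_succ, solCoeff_succ, solCoeff_succ]
      simp only [key, Finset.sum_add_distrib, smul_add, ← Finset.smul_sum]
      congr 1
      exact smul_comm _ _ _

/-! ### 3. Baker's system at a regular point -/

section Regular

variable (f : K[X]) (G : Matrix (Fin n) (Fin n) K[X]) {z₀ : K}

/-- The coefficient matrix `A = f(X+z₀)⁻¹ · G(X+z₀) ∈ Mₙ(K⟦X⟧)` of Baker's system (1) expanded at
a regular point `z₀` (`f(z₀) ≠ 0`). [folklore] -/
def regMatrix (hf : f.eval z₀ ≠ 0) : Matrix (Fin n) (Fin n) (PowerSeries K) :=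
  fun i j => ↑((isUnit_shiftAlgHom K hf).unit⁻¹) * shiftAlgHom K z₀ (G i j)

/-- The fundamental solutions `w_l`, `l = 1, …, n`, of (1) at the regular point `z₀`:
`w_l(0) = e_l`. [folklore] -/
def fundSol (hf : f.eval z₀ ≠ 0) (l : Fin n) : Fin n → PowerSeries K :=
  solSeries (regMatrix f G hf) (Pi.single l 1)

/-- Each `w_l` solves `f(X+z₀) wᵢ′ = ∑ⱼ Gᵢⱼ(X+z₀) wⱼ`, i.e. is a solution in the sense of
`IsSol (shiftAlgHom K z₀)`. [folklore] -/
theorem isSol_fundSol [CharZero K] (hf : f.eval z₀ ≠ 0) (l : Fin n) :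
    IsSol (shiftAlgHom K z₀) (PowerSeries.derivative K) f G (fundSol f G hf l) := by
  intro i
  rw [fundSol, derivative_solSeries, Finset.mul_sum]
  refine Finset.sum_congr rfl fun j _ => ?_
  rw [regMatrix, ← mul_assoc, ← mul_assoc, IsUnit.mul_val_inv, one_mul]

/-- More generally every `solSeries (regMatrix …) v` is a solution. [folklore] -/
theorem isSol_solSeries_regMatrix [CharZero K] (hf : f.eval z₀ ≠ 0) (v : Fin n → K) :
    IsSol (shiftAlgHom K z₀) (PowerSeries.derivative K) f G (solSeries (regMatrix f G hf) v) := by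
  intro i
  rw [derivative_solSeries, Finset.mul_sum]
  refine Finset.sum_congr rfl fun j _ => ?_
  rw [regMatrix, ← mul_assoc, ← mul_assoc, IsUnit.mul_val_inv, one_mul]

/-- Initial values: `w_l(0) = e_l`. [folklore] -/
theorem constantCoeff_fundSol (hf : f.eval z₀ ≠ 0) (l i : Fin n) :
    constantCoeff (fundSol f G hf l i) = (Pi.single l 1 : Fin n → K) i := by
  rw [fundSol, constantCoeff_solSeries]

/-- **The fundamental solutions are linearly independent over `K`** (their initial values are
the standard basis). [folklore] -/
theorem linearIndependent_fundSol (hf : f.eval z₀ ≠ 0) : LinearIndependent K (fundSol f G hf) := by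
  rw [Fintype.linearIndependent_iff]
  intro κ hκ l
  have h := congr_arg (fun y : Fin n → PowerSeries K => constantCoeff (y l)) hκ
  simp only [Finset.sum_apply, Pi.smul_apply, map_sum, Pi.zero_apply, map_zero,
    PowerSeries.smul_eq_C_mul, map_mul, constantCoeff_C, constantCoeff_fundSol] at h
  rw [Finset.sum_eq_single l] at h
  · simpa using h
  · intro l' _ hl'
    rw [Pi.single_eq_of_ne (Ne.symm hl'), mul_zero]
  · simp

end Regular

/-! ### 4. Regular points exist -/

/-- A non-zero polynomial over a field of characteristic zero has a non-root (the field is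
infinite). [folklore] -/
theorem exists_eval_ne_zero [CharZero K] {f : K[X]} (hf : f ≠ 0) : ∃ z₀ : K, f.eval z₀ ≠ 0 := by
  haveI : Infinite K := Infinite.of_injective _ Nat.cast_injective
  by_contra h
  push Not at h
  exact hf (Polynomial.funext (by simpa using h))

end SiegelShidlovskii

end Literature.Barriers.Schanuel

end
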